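import Summits.ABC.IUTFork.Cor312VerbatimReadings
import HarnessLib

/-!
# The fork at [IUTchIII] Corollary 3.12 — READING 4: containment up to isomorphism (Yamashita), and the pointwise reading

Record-only file (D-0012) of the abc-iut cell (Cor. 3.12 STRATEGY TEAM A «direct III§3», D-0067, seat
abc-iut-c312-9 = A1, row A-4 of `HOME/plan/C312-TEAMS.md`); TAKES NO SIDE. The team's charter is to
discharge Cor. 3.12 from the typed Thm. 3.11 (i)–(iii) interfaces step by step as printed, each inference a
kernel lemma; the disputed passage is Steps (xi-f)/(xi-g) (kurims `paper:url-4b091feeb646` p. 184 l. 19–34: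
"constitutes … a construction … of `−|log(q)|`. The inclusion … then follows formally"; Fig. 3.8 "two
tautologically equivalent ways to compute the log-volume of the `q`-pilot object"). The tree already carries
three sufficient readings of that passage over the verbatim setting (`Cor312StatementBridge`,
`Cor312VerbatimReadings`): R1 `statement_of_represented` (LANA §8.3), R2 `statement_of_qRegion_subset_thetaHull`,
R3 `statement_of_qRegion_mem_possibleImages`. This file adds the two WEAKER readings the team works against:

* `statement_of_qLocal_le` — **READING 0 (pointwise volumes)**: if at every label `j ∈ 𝔽_l^⋇` and every `v_ℚ`
  the local `q`-pilot log-volume is `≤` the local hull volume, the printed Statement follows (the two global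
  numbers are the same procession-normalized sums; `finsum_le_finsum'` + `processionNormalized_mono`). This is
  the weakest volume-level interface: every other reading factors through it.
* `IsoContainment` / `statement_of_isoContainment` — **READING 4 (containment up to isomorphism)**: Yamashita's
  one-paragraph proof of his Cor. 13.13 (= Cor. 3.12) renders Step (xi) as: "in the mono-analytic containers
  (i.e., Q-spans of log-shells), the holomorphic hull of the union of possible images of Θ-pilot objects
  subject to indeterminacies (Indet ↷), (Indet →), (Indet ↑) contains a region which is **isomorphic (not
  equal)** to the region determined by the q-pilot objects" [cite: Yamashita2024IUTSurvey, Cor 13.13 proof,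
  printed p. 360 = PDF p. 390 ll. 30–40] — typed: in every packet there is an admissible `R′ ⊆ ^{n,∘}𝒰_{j,v_ℚ}`
  whose log-volume equals the local `q`-pilot log-volume. The log-volume invariance his parenthesis leans on
  ("log-volumes are invariant under (Indet ↷), (Indet →), and also compatible with log-Kummer correspondence")
  is exactly what produces such an `R′` from an isomorph of the `q`-region; the explicit image form is
  `statement_of_isomorphic_subregion`. R3 ⟹ R2 ⟹ R4 (`qRegion_subset_thetaHull_of_mem_possibleImages`,
  `isoContainment_of_qRegion_subset_thetaHull`), so R4 is the weakest set-level reading in the catalogue and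
  the team's GAP statement targets it.
* `realEdges_of_isoContainment` — the wiring of R4 into c312-2's chain edges (`RealEdges O (verbatimVolumes H hq)`),
  so `cor312_of_chain` applies with (xi-f)'s observation read as R4.

`IsoContainment` is a HYPOTHESIS/reading definition of this cell's analysis (like `RepresentedVol`/`QSubHull`/
`QIsImage`/`BridgeHyps`), NOT a prerequisite fact in the sense of D-0067's FACT-LIST; nothing here asserts it.
Sources read on the page: [IUTchIII] pp. 173–175, 183–185; Yamashita 2024 pp. 359–360 (PDF pp. 389–390);
relay lit INBOX 2026-08-25T22:47:29Z. [claim: Mochizuki2012, status: disputed]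
Deliberately NOT here: any claim that a reading HOLDS for an instantiated setting (Team A rows A-0…A-3);
any judgement on (xi-f).
-/

noncomputable section

namespace Summit.ABC

namespace IUTFork

namespace Cor312Vol

open Thm311 Cor312 Cor312Proof Literature.IUT.LogThetaLattice

/-! ## 1. Procession-normalization is monotone -/

/-- The procession-normalized log-volume (L6-t4, [IUTchIII] Prop. 3.9 (i): the average over `j ∈ 𝔽_l^⋇`) is
monotone in the per-label volumes. [folklore] -/
theorem processionNormalized_mono {lstar : ℕ} {f g : Fin lstar → ℝ} (h : ∀ j, f j ≤ g j) :
    processionNormalized f ≤ processionNormalized g := by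
  unfold processionNormalized
  gcongr with j _
  exact h j

variable {T : ThetaIndex} {S : Situation T} {P : Cor312.Setting S}

/-! ## 2. READING 0: the pointwise volume inequality suffices -/

/-- **READING 0 (pointwise volumes) ⟹ the printed Statement.** If at every label `j = i+1 ∈ 𝔽_l^⋇` and every
`v_ℚ` the local `q`-pilot log-volume `qLocal` is at most the local hull volume `thetaLocal` (read as a real
number via `ThetaFinite`, `H.finite`), then "`−|log(Θ)| ∈ ℝ`, and `−|log(Θ)| ≥ −|log(q)|`" (Cor. 3.12 p. 174
l. 16–18): both global numbers are procession-normalized `finsum`s of the local ones (Prop. 3.9 (i)(iii)), with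
finite supports `qSupport_finite` resp. `ThetaFinite`. Every set-level reading factors through this lemma.
[claim: Mochizuki2012, status: disputed] -/
theorem statement_of_qLocal_le (H : BridgeHyps P)
    (h : ∀ (i : Fin T.lstar) (vQ : T.VQ),
      P.qLocal (Setting.labelSucc i) vQ ≤ (P.thetaLocal (Setting.labelSucc i) vQ).untopD 0) :
    P.Statement := by
  constructor
  · unfold Setting.negLogTheta
    rw [if_pos H.finite]
    exact WithTop.coe_ne_top
  · unfold Setting.negLogTheta
    rw [if_pos H.finite, WithTop.coe_le_coe]
    unfold Setting.negLogQ
    refine processionNormalized_mono fun i => ?_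
    refine finsum_le_finsum' ?_ ?_ fun vQ => h i vQ
    · exact P.qSupport_finite (Setting.labelSucc i)
    · exact H.finite.2 i

/-! ## 3. READING 4: containment up to isomorphism (Yamashita) -/

/-- **READING 4 — containment up to isomorphism** of Step (xi), as printed by Yamashita: in every packet
`𝓘^ℚ(^{S^±_{j+1}};^{n,∘}𝒟^⊢_{v_ℚ})` (label `j ∈ 𝔽_l^⋇`), the holomorphic hull `^{n,∘}𝒰_{j,v_ℚ}` of the union of the
possible images of the Θ-pilot object CONTAINS an admissible region `R′` whose mono-analytic log-volume equals
the local log-volume of the `q`-pilot image — "contains a region which is isomorphic (not equal) to the region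
determined by the q-pilot objects (This means that "very small region with indeterminacies" contains "almost
unit region")" [cite: Yamashita2024IUTSurvey, Cor 13.13 proof, printed p. 360 = PDF p. 390 ll. 30–40]. Weaker
than R2/R3 (the `q`-region itself need not lie in the hull). HYPOTHESIS/reading definition of this cell's
analysis (not a D-0067 prerequisite fact); never asserted. [claim: Mochizuki2012, status: disputed] -/
@[claim "Mochizuki2012" "disputed"] def IsoContainment (P : Cor312.Setting S) : Prop :=
  ∀ (i : Fin T.lstar) (vQ : T.VQ),
    ∃ R' : Set (S.L.Packet (Setting.labelSucc i) vQ),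
      R' ⊆ P.thetaHull (Setting.labelSucc i) vQ ∧
        (S.D P.n).Adm (Setting.labelSucc i) vQ R' ∧
          (S.D P.n).logvol (Setting.labelSucc i) vQ R' = P.qLocal (Setting.labelSucc i) vQ

/-- **READING 4 ⟹ the printed Statement** (under the bridge hypotheses `H`, which carry `ThetaFinite` and the
monotonicity `LogvolMono` of the log-volume of Thm. 3.11 (i) (a)): `qLocal = logvol R′ ≤ logvol ^{n,∘}𝒰 =
thetaLocal` in every packet (the hull is admissible by `thetaHull_adm` under `HullDefined`, which `ThetaFinite`
supplies), then READING 0. [claim: Mochizuki2012, status: disputed] -/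
theorem statement_of_isoContainment (H : BridgeHyps P) (h : IsoContainment P) : P.Statement := by
  refine statement_of_qLocal_le H fun i vQ => ?_
  obtain ⟨R', hsub, hadm, hvol⟩ := h i vQ
  rw [thetaLocal_untopD H, ← hvol]
  exact H.mono i vQ hadm (P.thetaHull_adm (hullDefined_of_finite H i vQ)) hsub

/-- READING 4 in the explicit image form of Yamashita's sentence: an ISOMORPHISM of the packet (a `ℚ`-linear
automorphism of the mono-analytic container — e.g. a composite of the Kummer/link isomorphisms his parenthesis
invokes) carries the `q`-pilot region into the hull, preserving admissibility and the log-volume ("log-volumes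
are invariant under (Indet ↷), (Indet →), and also compatible with log-Kummer correspondence", loc. cit.;
the invariance itself is Team A row A-1 content, consumed here as the equality hypothesis).
[claim: Mochizuki2012, status: disputed] -/
theorem statement_of_isomorphic_subregion (H : BridgeHyps P)
    (h : ∀ (i : Fin T.lstar) (vQ : T.VQ),
      ∃ Φ : S.L.Packet (Setting.labelSucc i) vQ ≃ₗ[ℚ] S.L.Packet (Setting.labelSucc i) vQ,
        Φ '' P.qRegion (Setting.labelSucc i) vQ ⊆ P.thetaHull (Setting.labelSucc i) vQ ∧
          (S.D P.n).Adm (Setting.labelSucc i) vQ (Φ '' P.qRegion (Setting.labelSucc i) vQ) ∧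
            (S.D P.n).logvol (Setting.labelSucc i) vQ (Φ '' P.qRegion (Setting.labelSucc i) vQ) =
              (S.D P.n).logvol (Setting.labelSucc i) vQ (P.qRegion (Setting.labelSucc i) vQ)) :
    P.Statement := by
  refine statement_of_isoContainment H fun i vQ => ?_
  obtain ⟨Φ, hsub, hadm, hvol⟩ := h i vQ
  exact ⟨Φ '' P.qRegion (Setting.labelSucc i) vQ, hsub, hadm, hvol⟩

/-! ## 4. The catalogue order: R3 ⟹ R2 ⟹ R4 at the verbatim level -/

/-- READING 3 ⟹ READING 2 in c312-7's nouns: a possible image lies in the union of all of them, which lies in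
its holomorphic hull (`HullFrame.subset_hull`). [folklore] -/
theorem qRegion_subset_thetaHull_of_mem_possibleImages
    (h : ∀ (i : Fin T.lstar) (vQ : T.VQ),
      P.qRegion (Setting.labelSucc i) vQ ∈ P.possibleImages (Setting.labelSucc i) vQ) :
    ∀ (i : Fin T.lstar) (vQ : T.VQ),
      P.qRegion (Setting.labelSucc i) vQ ⊆ P.thetaHull (Setting.labelSucc i) vQ :=
  fun i vQ =>
    (Set.subset_sUnion_of_mem (h i vQ)).trans ((P.frame (Setting.labelSucc i) vQ).subset_hull _)

/-- READING 2 ⟹ READING 4: take `R′` to be the `q`-pilot region itself (a hull-set, `qRegion_mem`, hence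
admissible, `hul_adm`; its log-volume is `qLocal` by definition). So R4 is the weakest of the set-level
readings R2/R3/R4. [folklore] -/
theorem isoContainment_of_qRegion_subset_thetaHull
    (h : ∀ (i : Fin T.lstar) (vQ : T.VQ),
      P.qRegion (Setting.labelSucc i) vQ ⊆ P.thetaHull (Setting.labelSucc i) vQ) :
    IsoContainment P :=
  fun i vQ =>
    ⟨P.qRegion (Setting.labelSucc i) vQ, h i vQ,
      P.hul_adm (Setting.labelSucc i) vQ _ (P.qRegion_mem (Setting.labelSucc i) vQ), rfl⟩

/-! ## 5. The wiring into the chain's real edges -/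

/-- READING 4 granted under (xi-f)'s observation ⟹ the real edges of c312-2's chain for the printed
statement's volumes — so `cor312_of_chain` applies with the disputed edge read as containment up to
isomorphism. [claim: Mochizuki2012, status: disputed] -/
theorem realEdges_of_isoContainment (H : BridgeHyps P) (hq : P.AbsLogQPos) {O : Obs → Prop}
    (h : O .constitutesConstruction → IsoContainment P) :
    RealEdges O (verbatimVolumes H hq) :=
  (realEdges_verbatim_iff H hq O).2 fun hc => statement_of_isoContainment H (h hc)

/-- **All 85 loci ∧ the 20-step chain ∧ the (xi-f) edge read as READING 4 ⟹ the printed statement** — the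
Team A composition of record at this level: what remains open for the team is exactly the three hypotheses
(the loci over the frozen definitions, the twenty inferences under an honest real reading, and R4).
[claim: Mochizuki2012, status: disputed] -/
theorem statement_of_chain_isoContainment (H : BridgeHyps P) (hq : P.AbsLogQPos)
    {L : Locus → Prop} {O : Obs → Prop} (hL : ∀ c, L c) (hC : Chain L O)
    (h : O .constitutesConstruction → IsoContainment P) : P.Statement :=
  (verbatimVolumes_cor312_iff H hq).1
    (cor312_of_chain hL hC (realEdges_of_isoContainment H hq h))

end Cor312Vol

end IUTFork

end Summit.ABC

end
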